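import Summits.CriticalPhenomena.CardyFormulaZ2.Theorems.CardyComplexConeEdgePrecompactUFRSCollarDecayRectScales
import Summits.CriticalPhenomena.CardyFormulaZ2.Theorems.CardyComplexConeEdgePrecompactUFRSCollarDecayRectGrid
import Summits.CriticalPhenomena.CardyFormulaZ2.Theorems.CardyComplexConeEdgePrecompactUFRSCollarDecayRectWeights

/-!
# Decay of the FAR branch of the UFRS collar certificate for axis-parallel rectangles
(line `qkz-strip-boundary-arm` of crux `CardyComplexCone.EdgePrecompact`, stmt-CriticalPhenomena-11387;
registered sub-goal `ufrs_screenedCollarDecay_rect_of_boundaryStrandDecay`: M3 of the UFRS road map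
for RECTANGLES, conditional on the registered single-scale bridge `ufrs_rectBoundaryStrandDecay`)

The statement proved: the single-scale decay of three strand-crossings at the boundary points of an
open axis-parallel rectangle `D` (one-arm rate `C (r/R)^α` everywhere, three-arm rate
`C (r/R)^{1+α}` away from the `A`–`B` edges of `E` and of `shiftData E w`) implies, for every
`ρ, ε > 0`, an `η₁ > 0` such that for `0 < η < η₁` and fine admissible data `E` on `D` and shifts
`w` with `‖E.δ w‖ < η`,
`P_{1/2}{ω | ∃ z ∈ D, infDist z Dᶜ < 3η ∧ ω ∈ ufrsCertFar E w z (4η) (ρ/2)} ≤ ε`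
— verbatim the registered `ufrs_screenedCollarDecay_rect` behind the bridge.

Proof (this file assembles the support files `…UFRSCollarDecayRect{Locality,Grid,Split,Scales}.lean`):
1. DISCRETISATION: the `3η`-collar of the rectangle is `4η`-close to a boundary grid `G` of
   `O(perimeter/η)` points (`exists_boundaryGrid`); the certificate at `z` transported to the grid
   point `p` (`certFar_subset_biUnion`, `ufrsStrands_mono`) reads, for a dyadic `d = ρ/2/2/2^k`,
   "three strands across `A(p; 8η, d/4)` (if `d ≥ 64η`) and across `A(p; 3d, ρ/8)`".
2. PER PIECE: `real_certPiece_le` bounds each (point, scale) piece by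
   `2^27 C₁⁴ (η/ŝ_p) (η/d)^{α/2} (d/ρ)^α`, `ŝ_p` the capped junction distance of `p`
   (`exists_cappedJunctionDist`, `exists_junctionFinset`): independence of the two nested annuli,
   three-arm rate below the junction scale, one-arm rate above it (three-scale analysis).
3. SUMMATION: over the scales the slack `(ρ/d)^{α/2}` is geometric (`phi_dyadic_le`); over the grid the junction weights `η/ŝ_p` sum to
   `O(perimeter/ρ) + O(log(ρ/η))` (`sum_shellWeight_le`: `16T/η + 4` grid points within `T` of a
   marked midpoint, `33` per dyadic shell, `shellCount_bounds` shells), so the total is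
   `O((η/ρ)^{α/2} log(ρ/η)) = O((η/ρ)^{α/4}) → 0` (`tendsto_totalBound`); `η₁` is read off the
   limit, `δ₀ = min δ₁(η) η`.

References: S. Smirnov, C. R. Acad. Sci. Paris 333 (2001), §2; G. F. Lawler, O. Schramm, W. Werner,
Electron. J. Probab. 7 (2002), App. A; H. Kesten, Comm. Math. Phys. 109 (1987); P. Nolin, Electron.
J. Probab. 13 (2008), §4; G. Grimmett, *Percolation* (1999), §2.2, §11.8.
-/

namespace Summit.CriticalPhenomena.CardyFormulaZ2.Cruxes.EdgePrecompact.QkzStripBoundaryArm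

open MeasureTheory Filter Set Metric
open scoped Topology BigOperators Pointwise
open Literature.Probability.LatticeModels Literature.Probability.Percolation
open Literature.Probability.RandomPlanarGeometry (DobrushinDomain)
open Summit.CriticalPhenomena.CardyFormulaZ2.Theses.CardyComplexCone

noncomputable section

/-! ## Transport of the certificate to the grid -/

/-- **The FAR certificate at a collar point, read at a nearby grid point.** If `dist z p < 4η`
(and `4096 η ≤ ρ`), the certificate `ufrsCertFar E w z (4η) (ρ/2)` implies, for some dyadic
`d = ρ/2/2/2^k` with `4η ≤ d`, `64 d ≤ ρ`, `k ≤ ρ/η`: three strands across `A(p; 8η, d/4)` if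
`d ≥ 64η`, and three strands across `A(p; 3d, ρ/8)` (`ufrsStrands_mono`). -/
theorem certFar_subset_biUnion (E : DiscreteDobrushin) (w : Site 2) {η ρ : ℝ} (hη : 0 < η)
    (hηρ : 4096 * η ≤ ρ) {z p : ℂ} (hzp : dist z p < 4 * η) :
    ufrsCertFar E w z (4 * η) (ρ / 2) ⊆
      ⋃ k ∈ (Finset.range (⌊ρ / η⌋₊ + 1)).filter
          (fun k => 4 * η ≤ ρ / 2 / 2 / 2 ^ k ∧ 64 * (ρ / 2 / 2 / 2 ^ k) ≤ ρ),
        {ω | (64 * η ≤ ρ / 2 / 2 / 2 ^ k → ω ∈ ufrsStrands E w p 3 (8 * η) (ρ / 2 / 2 / 2 ^ k / 4)) ∧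
          ω ∈ ufrsStrands E w p 3 (3 * (ρ / 2 / 2 / 2 ^ k)) (ρ / 8)} := by
  intro ω hω
  rw [mem_ufrsCertFar_iff] at hω
  obtain ⟨d, ⟨k, rfl⟩, h4, h16, hin, hout⟩ := hω
  have hρ : 0 < ρ := by linarith
  have h2k : (0:ℝ) < 2 ^ k := pow_pos two_pos k
  simp only [Set.mem_iUnion, Finset.mem_filter, Finset.mem_range, exists_prop]
  refine ⟨k, ⟨?_, h4, by linarith⟩, fun h64 => ?_, ?_⟩
  · -- `k ≤ ρ/η`
    have hk2 : (k : ℝ) ≤ 2 ^ k := by exact_mod_cast Nat.lt_two_pow_self.le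
    have h4' : 4 * η * 2 ^ k ≤ ρ / 2 / 2 := by rwa [le_div_iff₀ h2k] at h4
    have hkη : (k : ℝ) ≤ ρ / η := by
      rw [le_div_iff₀ hη]; nlinarith
    exact Nat.lt_succ_of_le (Nat.le_floor hkη)
  · exact ufrsStrands_mono (by linarith [hzp]) (by linarith [hzp]) (hin (by linarith))
  · exact ufrsStrands_mono (by linarith [hzp]) (by linarith [hzp]) hout

/-! ## The decay of the FAR branch for rectangles, from the single-scale bridge -/

/-- The total bound tends to zero with the collar width. -/
theorem tendsto_totalBound {A q ρ θ Per c : ℝ} (hθ : 0 < θ) :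
    Tendsto (fun η : ℝ => A / (1 - q) * ((η / ρ) ^ (2 * θ) * (10 * (Per + 8 * η) / ρ + 132) +
      c * (η / ρ) ^ θ)) (𝓝[>] 0) (𝓝 0) := by
  apply tendsto_nhdsWithin_of_tendsto_nhds
  have hg : ∀ e : ℝ, 0 < e → Tendsto (fun η : ℝ => (η / ρ) ^ e) (𝓝 0) (𝓝 0) := fun e he => by
    have h1 : Tendsto (fun η : ℝ => η / ρ) (𝓝 0) (𝓝 0) := by
      simpa using (tendsto_id (x := 𝓝 (0:ℝ))).div_const ρ
    have h2 := (Real.continuousAt_rpow_const 0 e (Or.inr he.le)).tendsto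
    rw [Real.zero_rpow he.ne'] at h2
    exact h2.comp h1
  have hh : Tendsto (fun η : ℝ => 10 * (Per + 8 * η) / ρ + 132) (𝓝 0) (𝓝 (10 * (Per + 8 * 0) / ρ + 132)) := by
    have : Continuous (fun η : ℝ => 10 * (Per + 8 * η) / ρ + 132) := by fun_prop
    exact this.tendsto 0
  have := (((hg _ (by positivity : 0 < 2 * θ)).mul hh).add ((hg θ hθ).const_mul c)).const_mul (A / (1 - q))
  simpa using this

/-- **Decay of the FAR branch of the collar certificate for axis-parallel rectangles, from the
single-scale boundary bounds** (registered sub-goal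
`ufrs_screenedCollarDecay_rect_of_boundaryStrandDecay` of stmt-CriticalPhenomena-11387; with the
registered bridge `ufrs_rectBoundaryStrandDecay` it yields `ufrs_screenedCollarDecay_rect`, M3 of
the UFRS road map, verbatim). Proof: discretise the `3η`-collar by the boundary grid
(`exists_boundaryGrid`), transport the certificate to the grid (`certFar_subset_biUnion`), bound
each (point, scale) piece by `real_certPiece_le` with the point's capped junction distance
(`exists_cappedJunctionDist`, `exists_junctionFinset`), sum the geometric series over the scales
(`phi_dyadic_le`, a geometric series) and the junction weights over the grid (`sum_shellWeight_le`,
`shellCount_bounds`): the total is `O((η/ρ)^{α/4})`, uniformly in the mesh and the shift. -/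
theorem ufrs_screenedCollarDecay_rect_of_boundaryStrandDecay : (∀ (D : DobrushinDomain), (∃ x₀ x₁ y₀ y₁ : ℝ, x₀ < x₁ ∧ y₀ < y₁ ∧ D.carrier = Set.Ioo x₀ x₁ ×ℂ Set.Ioo y₀ y₁) → ∃ C α K : ℝ, 0 < C ∧ 0 < α ∧ 0 < K ∧ ∀ η : ℝ, 0 < η → ∃ δ₁ > (0:ℝ), ∀ E : DiscreteDobrushin, E.Ω = D.carrier → E.IsZdAdmissible → E.δ < δ₁ → ∀ w : Site 2, ‖meshPoint E.δ w‖ < η → ∀ (z : ℂ) (r R : ℝ), z ∈ frontier D.carrier → 8 * η ≤ r → K * r ≤ R → (bondPercolation (zdGraph 2) half).real (ufrsStrands E w z 3 r R) ≤ C * (r / R) ^ α ∧ (z ∉ ufrsMarkedNbhd E w (2 * R) → (bondPercolation (zdGraph 2) half).real (ufrsStrands E w z 3 r R) ≤ C * (r / R) ^ (1 + α))) → ∀ (D : DobrushinDomain), (∃ x₀ x₁ y₀ y₁ : ℝ, x₀ < x₁ ∧ y₀ < y₁ ∧ D.carrier = Set.Ioo x₀ x₁ ×ℂ Set.Ioo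 y₀ y₁) → ∀ ρ > (0:ℝ), ∀ ε > (0:ℝ), ∃ η₁ > (0:ℝ), ∀ η : ℝ, 0 < η → η < η₁ → ∃ δ₀ > (0:ℝ), ∀ E : DiscreteDobrushin, E.Ω = D.carrier → E.IsZdAdmissible → E.δ < δ₀ → ∀ w : Site 2, ‖meshPoint E.δ w‖ < η → (bondPercolation (zdGraph 2) half).real {ω : BondConfig (Site 2) | ∃ z ∈ D.carrier, infDist z D.carrierᶜ < 3 * η ∧ ω ∈ ufrsCertFar E w z (4 * η) (ρ / 2)} ≤ ε := by
  intro hbridge D hrect ρ hρ ε hε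
  obtain ⟨x₀, x₁, y₀, y₁, hx, hy, hD⟩ := hrect
  obtain ⟨C, α, K, hC, hα, hK, hB⟩ := hbridge D ⟨x₀, x₁, y₀, y₁, hx, hy, hD⟩
  -- normalised constants
  set C₁ : ℝ := max C 1 * (max K 2) ^ 2 with hC₁def
  set α₁ : ℝ := min α 1 with hα₁def
  set θ : ℝ := α₁ / 4 with hθdef
  have hC₁ : 1 ≤ C₁ := by
    have h1 : (1:ℝ) ≤ max C 1 := le_max_right _ _
    have h2 : (1:ℝ) ≤ (max K 2) ^ 2 := by nlinarith [le_max_right K 2]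
    nlinarith
  have hα₁ : 0 < α₁ := lt_min hα one_pos
  have hα₁1 : α₁ ≤ 1 := min_le_right _ _
  have hθ : 0 < θ := by positivity
  have h2θ : α₁ / 2 = 2 * θ := by rw [hθdef]; ring
  set q : ℝ := (2:ℝ) ^ (-(α₁ / 2)) with hqdef
  have hq0 : 0 < q := by positivity
  have hq1 : q < 1 := Real.rpow_lt_one_of_one_lt_of_neg (by norm_num) (by linarith)
  set A : ℝ := 2 ^ 27 * C₁ ^ 4 with hAdef
  have hA0 : 0 ≤ A := by positivity
  set Per : ℝ := 2 * (x₁ - x₀) + 2 * (y₁ - y₀) with hPerdef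
  have h2θ1 : 1 < (2:ℝ) ^ θ := Real.one_lt_rpow (by norm_num) hθ
  -- choice of `η₁`
  have hev : ∀ᶠ η in 𝓝[>] (0:ℝ), A / (1 - q) * ((η / ρ) ^ (2 * θ) * (10 * (Per + 8 * η) / ρ + 132) +
      132 / ((2:ℝ) ^ θ - 1) * (η / ρ) ^ θ) < ε ∧ η < min (min (x₁ - x₀) (y₁ - y₀)) (ρ / 4096) := by
    refine ((tendsto_totalBound (A := A) (q := q) (ρ := ρ) (Per := Per) (c := 132 / ((2:ℝ) ^ θ - 1)) hθ).eventually
      (Iio_mem_nhds hε)).and ?_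
    have hpos : 0 < min (min (x₁ - x₀) (y₁ - y₀)) (ρ / 4096) :=
      lt_min (lt_min (by linarith) (by linarith)) (by positivity)
    exact nhdsWithin_le_nhds (Iio_mem_nhds hpos)
  rw [eventually_nhdsWithin_iff, Metric.eventually_nhds_iff] at hev
  obtain ⟨η₁, hη₁, hev⟩ := hev
  refine ⟨η₁, hη₁, fun η hη0 hηlt => ?_⟩
  obtain ⟨hTot, hηmin⟩ := hev (show dist η 0 < η₁ by rw [dist_zero_right, Real.norm_eq_abs, abs_of_pos hη0]; exact hηlt) hη0
  have hηx : η ≤ x₁ - x₀ := (hηmin.le.trans (min_le_left _ _)).trans (min_le_left _ _)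
  have hηy : η ≤ y₁ - y₀ := (hηmin.le.trans (min_le_left _ _)).trans (min_le_right _ _)
  have hηρ : 4096 * η ≤ ρ := by linarith [hηmin.le.trans (min_le_right _ _)]
  -- choice of `δ₀`
  obtain ⟨δ₁, hδ₁, hB'⟩ := hB η hη0
  refine ⟨min δ₁ η, lt_min hδ₁ hη0, fun E hEΩ hE hEδ w hw => ?_⟩
  have hδ : 0 < E.δ := hE.delta_pos
  have hδη : E.δ ≤ η := (hEδ.trans_le (min_le_right _ _)).le
  have hEδ₁ : E.δ < δ₁ := hEδ.trans_le (min_le_left _ _)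
  set μ := bondPercolation (zdGraph 2) half with hμ
  -- the normalised bridge at `(E, w)`
  obtain ⟨hO, hF⟩ := bridge_normalize (S := frontier D.carrier) hα hK hη0
    (fun z r R hz hr hR => hB' E hEΩ hE hEδ₁ w hw z r R hz hr hR)
  -- grid and junctions
  obtain ⟨G, hGfr, hGcard, hGcov, hGcnt⟩ := exists_boundaryGrid x₀ x₁ y₀ y₁ η hx hy hη0 hηx hηy
  obtain ⟨J, hJcard, hJ⟩ := exists_junctionFinset hE w
  have hŝex := fun p : ℂ => exists_cappedJunctionDist (E := E) (w := w) J hJ hη0 (by linarith : 128 * η ≤ ρ) p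
  choose ŝf hŝ1 hŝ2 hŝ3 hŝ4 using hŝex
  -- the pieces
  set Kf := (Finset.range (⌊ρ / η⌋₊ + 1)).filter
    (fun k => 4 * η ≤ ρ / 2 / 2 / 2 ^ k ∧ 64 * (ρ / 2 / 2 / 2 ^ k) ≤ ρ) with hKf
  set T : ℂ → ℕ → Set (BondConfig (Site 2)) := fun p k =>
    {ω | (64 * η ≤ ρ / 2 / 2 / 2 ^ k → ω ∈ ufrsStrands E w p 3 (8 * η) (ρ / 2 / 2 / 2 ^ k / 4)) ∧
      ω ∈ ufrsStrands E w p 3 (3 * (ρ / 2 / 2 / 2 ^ k)) (ρ / 8)} with hT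
  -- covering
  have hsub : {ω : BondConfig (Site 2) | ∃ z ∈ D.carrier, infDist z D.carrierᶜ < 3 * η ∧
      ω ∈ ufrsCertFar E w z (4 * η) (ρ / 2)} ⊆ ⋃ p ∈ G, ⋃ k ∈ Kf, T p k := by
    rintro ω ⟨z, hz, hzd, hcert⟩
    rw [hD] at hz hzd
    obtain ⟨p, hp, hzp⟩ := hGcov z hz hzd
    have := certFar_subset_biUnion E w hη0 hηρ hzp hcert
    exact Set.mem_iUnion₂.2 ⟨p, hp, this⟩
  -- per-piece bound
  have hpiece : ∀ p ∈ G, ∀ k ∈ Kf, μ.real (T p k) ≤ A * (η / ŝf p) * ((η / ρ) ^ (2 * θ) * q ^ k) := by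
    intro p hp k hk
    obtain ⟨-, h4, h64⟩ := Finset.mem_filter.1 hk
    have hfr : p ∈ frontier D.carrier := by rw [hD]; exact hGfr p hp
    calc μ.real (T p k) ≤ A * (η / ŝf p) * ((η / (ρ / 2 / 2 / 2 ^ k)) ^ (α₁ / 2) * (ρ / 2 / 2 / 2 ^ k / ρ) ^ α₁) :=
          real_certPiece_le hC₁ hα₁ hα₁1 hη0 hδ hδη hO hF hfr (hŝ1 p) (hŝ2 p) (hŝ3 p) h4 h64
      _ ≤ A * (η / ŝf p) * ((η / ρ) ^ (α₁ / 2) * q ^ k) :=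
          mul_le_mul_of_nonneg_left (phi_dyadic_le hη0 hρ hα₁ k)
            (mul_nonneg hA0 (div_nonneg hη0.le (by linarith [hŝ1 p])))
      _ = A * (η / ŝf p) * ((η / ρ) ^ (2 * θ) * q ^ k) := by rw [h2θ]
  -- the geometric sum over the scales
  have hgeom : ∑ k ∈ Kf, q ^ k ≤ 1 / (1 - q) := by
    refine (Finset.sum_le_sum_of_subset_of_nonneg (Finset.filter_subset _ _) fun k _ _ => by positivity).trans ?_
    have h := geom_sum_mul_neg q (⌊ρ / η⌋₊ + 1)
    rw [le_div_iff₀ (by linarith), h]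
    linarith [pow_nonneg hq0.le (⌊ρ / η⌋₊ + 1)]
  -- the junction weights
  have hJn := shellCount_bounds (ρ := ρ) hη0 (by linarith) hθ
  set Jn : ℕ := Nat.log 2 ⌊ρ / η⌋₊ + 1 with hJndef
  have hW : ∑ p ∈ G, η / ŝf p ≤ 5 * (G.card * (2 * η / ρ)) + 132 * Jn := by
    calc ∑ p ∈ G, η / ŝf p ≤ ∑ p ∈ G, (2 * η / ρ + ∑ m ∈ J, η / max (64 * η) (dist m p)) :=
          Finset.sum_le_sum fun p _ => hŝ4 p
      _ = G.card * (2 * η / ρ) + ∑ m ∈ J, ∑ p ∈ G, η / max (64 * η) (dist m p) := by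
          rw [Finset.sum_add_distrib, Finset.sum_const, nsmul_eq_mul, Finset.sum_comm]
      _ ≤ G.card * (2 * η / ρ) + ∑ m ∈ J, (G.card * (2 * η / ρ) + 33 * Jn) := by
          gcongr with m hm
          exact sum_shellWeight_le G η ρ m _ hη0 hρ hGcnt (by omega) hJn.1
      _ = G.card * (2 * η / ρ) * (1 + J.card) + J.card * (33 * Jn) := by
          rw [Finset.sum_const, nsmul_eq_mul]; ring
      _ ≤ G.card * (2 * η / ρ) * (1 + 4) + 4 * (33 * Jn) := by
          have hJ4 : (J.card : ℝ) ≤ 4 := by exact_mod_cast hJcard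
          gcongr
      _ = 5 * (G.card * (2 * η / ρ)) + 132 * Jn := by ring
  -- assembling
  have hT0 : ∀ p ∈ G, ∀ k ∈ Kf, 0 ≤ μ.real (T p k) := fun _ _ _ _ => measureReal_nonneg
  calc μ.real {ω : BondConfig (Site 2) | ∃ z ∈ D.carrier, infDist z D.carrierᶜ < 3 * η ∧
        ω ∈ ufrsCertFar E w z (4 * η) (ρ / 2)}
      ≤ μ.real (⋃ p ∈ G, ⋃ k ∈ Kf, T p k) := measureReal_mono hsub (measure_ne_top _ _)
    _ ≤ ∑ p ∈ G, μ.real (⋃ k ∈ Kf, T p k) := measureReal_biUnion_finset_le G _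
    _ ≤ ∑ p ∈ G, ∑ k ∈ Kf, μ.real (T p k) := Finset.sum_le_sum fun p _ => measureReal_biUnion_finset_le Kf _
    _ ≤ ∑ p ∈ G, ∑ k ∈ Kf, A * (η / ŝf p) * ((η / ρ) ^ (2 * θ) * q ^ k) :=
        Finset.sum_le_sum fun p hp => Finset.sum_le_sum fun k hk => hpiece p hp k hk
    _ = A * (η / ρ) ^ (2 * θ) * ((∑ p ∈ G, η / ŝf p) * (∑ k ∈ Kf, q ^ k)) := by
        rw [Finset.sum_mul_sum]
        rw [Finset.mul_sum]
        refine Finset.sum_congr rfl fun p _ => ?_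
        rw [Finset.mul_sum]
        refine Finset.sum_congr rfl fun k _ => ?_
        ring
    _ ≤ A * (η / ρ) ^ (2 * θ) * ((5 * (G.card * (2 * η / ρ)) + 132 * Jn) * (1 / (1 - q))) := by
        refine mul_le_mul_of_nonneg_left (mul_le_mul hW hgeom (Finset.sum_nonneg fun k _ => by positivity)
          (by positivity)) (by positivity)
    _ ≤ A * (η / ρ) ^ (2 * θ) * ((5 * (((2 * (x₁ - x₀) + 2 * (y₁ - y₀)) / η + 8) * (2 * η / ρ)) +
          132 * (1 + (ρ / η) ^ θ / ((2:ℝ) ^ θ - 1))) * (1 / (1 - q))) := by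
        refine mul_le_mul_of_nonneg_left (mul_le_mul_of_nonneg_right (add_le_add
          (mul_le_mul_of_nonneg_left (mul_le_mul_of_nonneg_right hGcard (by positivity)) (by norm_num))
          (mul_le_mul_of_nonneg_left hJn.2 (by norm_num))) ?_) (by positivity)
        have h1q : 0 < 1 - q := by linarith
        positivity
    _ = A / (1 - q) * ((η / ρ) ^ (2 * θ) * (10 * (Per + 8 * η) / ρ + 132) +
          132 / ((2:ℝ) ^ θ - 1) * (η / ρ) ^ θ) := by
        have hu : 0 < η / ρ := by positivity
        have hid : (η / ρ) ^ (2 * θ) * (ρ / η) ^ θ = (η / ρ) ^ θ := by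
          rw [show ρ / η = (η / ρ)⁻¹ by rw [inv_div], Real.inv_rpow hu.le, mul_comm (2:ℝ) θ,
            Real.rpow_mul hu.le, Real.rpow_two]
          have : (η / ρ) ^ θ ≠ 0 := (Real.rpow_pos_of_pos hu θ).ne'
          field_simp
        rw [← hid, ← hPerdef]
        set U2 := (η / ρ) ^ (2 * θ) with hU2
        set P1 := (ρ / η) ^ θ with hP1
        set B := (2:ℝ) ^ θ with hBdef
        have h21 : B - 1 ≠ 0 := by rw [hBdef]; linarith
        have h1q : 1 - q ≠ 0 := by linarith
        have hη0' : η ≠ 0 := hη0.ne'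
        have hρ0' : ρ ≠ 0 := hρ.ne'
        field_simp
        ring
    _ ≤ ε := hTot.le


/-- The registered bridge `ufrs_rectBoundaryStrandDecay` (as a hypothesis) and this file give the
registered `ufrs_screenedCollarDecay_rect` verbatim (syntactic match certified). -/
example (hbridge : ∀ (D : DobrushinDomain), (∃ x₀ x₁ y₀ y₁ : ℝ, x₀ < x₁ ∧ y₀ < y₁ ∧ D.carrier = Set.Ioo x₀ x₁ ×ℂ Set.Ioo y₀ y₁) → ∃ C α K : ℝ, 0 < C ∧ 0 < α ∧ 0 < K ∧ ∀ η : ℝ, 0 < η → ∃ δ₁ > (0:ℝ), ∀ E : DiscreteDobrushin, E.Ω = D.carrier → E.IsZdAdmissible → E.δ < δ₁ → ∀ w : Site 2, ‖meshPoint E.δ w‖ < η → ∀ (z : ℂ) (r R : ℝ), z ∈ frontier D.carrier → 8 * η ≤ r → K * r ≤ R → (bondPercolation (zdGraph 2) half).real (ufrsStrands E w z 3 r R) ≤ C * (r / R) ^ α ∧ (z ∉ ufrsMarkedNbhd E w (2 * R) → (bondPercolation (zdGraph 2) half).real (ufrsStrands E w z 3 r R) ≤ C * (r / R) ^ (1 +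 α))) : ∀ (D : DobrushinDomain), (∃ x₀ x₁ y₀ y₁ : ℝ, x₀ < x₁ ∧ y₀ < y₁ ∧ D.carrier = Set.Ioo x₀ x₁ ×ℂ Set.Ioo y₀ y₁) → ∀ ρ > (0:ℝ), ∀ ε > (0:ℝ), ∃ η₁ > (0:ℝ), ∀ η : ℝ, 0 < η → η < η₁ → ∃ δ₀ > (0:ℝ), ∀ E : DiscreteDobrushin, E.Ω = D.carrier → E.IsZdAdmissible → E.δ < δ₀ → ∀ w : Site 2, ‖meshPoint E.δ w‖ < η → (bondPercolation (zdGraph 2) half).real {ω : BondConfig (Site 2) | ∃ z ∈ D.carrier, infDist z D.carrierᶜ < 3 * η ∧ ω ∈ ufrsCertFar E w z (4 * η) (ρ / 2)} ≤ ε :=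
  ufrs_screenedCollarDecay_rect_of_boundaryStrandDecay hbridge

end

end Summit.CriticalPhenomena.CardyFormulaZ2.Cruxes.EdgePrecompact.QkzStripBoundaryArm
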